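import Summits.Ventures.PercRepro.ProfilePointedCircuitClassesInOutTenE

/-!
# PercRepro — THE IN–OUT INEQUALITY FROM A LOCAL LYM OF THE DISJOINTNESS RELATION, AND THE REDUCTION OF
`InOutBottomFour` AT `ρ ≥ 8` TO ONE INEQUALITY ABOUT A SPANNING 5-SET AND THREE FURTHER POINTS (p5, gen 40;
`proofs/P5-GM1.md` §59 ADDENDUM 4)

Demands `𝒟` (bi-independent `4`-sets `W ∋ e`), units `𝒰` (bi-independent `5`-sets `W' ∌ e`), relation `W ∩ W' = ∅`.
If every demand has a neighbour and the LOCAL LYM holds on every edge — the unit's degree `p(W')` is at most the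
demand's degree `s(W)` — then the weighting `1 / s(W)` of the edges is a fractional matching: every demand sends
total weight `1`, every unit receives `Σ 1/s(W) ≤ Σ 1/p(W') ≤ 1`, so `#𝒟 ≤ #𝒰` (`card_le_card_of_localLYM`, for any
relation).  For a unit `W'` and a disjoint demand `W` put `Y := E ∖ W ∖ W'` (`ρ − 5` points); every demand `X` disjoint
from `W'` is `e` plus a part of `W − e` plus a part `Z` of `Y`, and `E ∖ Z ⊇ E ∖ X` spans, so
`p(W') ≤ 1 + 3·#Y + 3·ι₂(Y) + ι₃(Y)` with `ι_j(Y) := #{Z ∈ C(Y, j) : E ∖ Z spans}` (`card_filter_disjoint_demands_le_I`);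
and `s(W) = #{X ∈ C(E ∖ W, 5) : E ∖ X independent}` (`card_filter_disjoint_units_eq`).  THE STATEMENT `StarStar`
(a `Prop`, NOT asserted; §59 ADD 4 (***): exhaustively true for `#Y = 3, 4` over the catalogues of all matroids on
`8` and `9` elements, 0 failures on ≈ `10⁸` random cases up to `#Y = 6`, ADD 5): on every coloop-free matroid of
nullity `4`, for every `5`-set `S` with `E ∖ S` independent and every `Y ⊆ E ∖ S` with `#Y ≥ 3`,
`1 + 3·#Y + 3·ι₂(Y) + ι₃(Y) ≤ #{X ∈ C(S ∪ Y, 5) : E ∖ X independent}` — in the dual: the number of spanning 5-subsets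
of `S ∪ Y` is at least `1 + 3#Y + 3ι₂ + ι₃`.  It gives the local LYM for `ρ ≥ 8`, hence
**`inCount_four_le_outCount_five_of_starStar`**: `in_4(e) ≤ out_5(e)` on every coloop-free matroid with `#E = ρ + 4`,
`ρ ≥ 8`, modulo `StarStar`.
-/

open scoped Matroid

namespace PercRepro.Cogirth

open Finset ThmH Skew Shadow Profile

variable {α : Type} [DecidableEq α]

section LocalLYM

/-- **A local LYM gives an injection in the count**: for finsets `D`, `U` and a relation `r` such that every `W ∈ D`
has a neighbour and, on every edge `r W W'`, the degree of `W'` in `D` is at most the degree of `W` in `U`,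
`#D ≤ #U` (the weighting `1 / deg W` of the edges). -/
theorem card_le_card_of_localLYM {β γ : Type} [DecidableEq β] [DecidableEq γ] {D : Finset β} {U : Finset γ}
    (r : β → γ → Prop) [DecidableRel r]
    (hs : ∀ W ∈ D, 0 < (U.filter (fun W' => r W W')).card)
    (hLYM : ∀ W ∈ D, ∀ W' ∈ U, r W W' →
      (D.filter (fun X => r X W')).card ≤ (U.filter (fun X' => r W X')).card) :
    D.card ≤ U.card := by
  -- the weight of the edge `(W, W')` is `1 / s(W)`
  have key : (D.card : ℚ) = ∑ W ∈ D, ∑ W' ∈ U,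
      (if r W W' then (1 : ℚ) / ((U.filter (fun X' => r W X')).card : ℚ) else 0) := by
    rw [card_eq_sum_ones, Nat.cast_sum]
    apply sum_congr rfl
    intro W hW
    rw [← sum_filter, sum_const, nsmul_eq_mul]
    have hpos : ((U.filter (fun X' => r W X')).card : ℚ) ≠ 0 := by
      have := hs W hW
      positivity
    rw [Nat.cast_one, mul_one_div_cancel hpos]
  have hswap : (∑ W ∈ D, ∑ W' ∈ U,
      (if r W W' then (1 : ℚ) / ((U.filter (fun X' => r W X')).card : ℚ) else 0)) =
      ∑ W' ∈ U, ∑ W ∈ D,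
      (if r W W' then (1 : ℚ) / ((U.filter (fun X' => r W X')).card : ℚ) else 0) := sum_comm
  -- every unit receives at most `1`
  have hunit : ∀ W' ∈ U, (∑ W ∈ D,
      (if r W W' then (1 : ℚ) / ((U.filter (fun X' => r W X')).card : ℚ) else 0)) ≤ 1 := by
    intro W' hW'
    rw [← sum_filter]
    rcases (D.filter (fun X => r X W')).eq_empty_or_nonempty with hemp | hne
    · rw [hemp, sum_empty]; exact zero_le_one
    · have hp : (0 : ℚ) < ((D.filter (fun X => r X W')).card : ℚ) := by
        exact_mod_cast card_pos.2 hne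
      calc (∑ W ∈ D.filter (fun X => r X W'), (1 : ℚ) / ((U.filter (fun X' => r W X')).card : ℚ))
          ≤ ∑ W ∈ D.filter (fun X => r X W'), (1 : ℚ) / ((D.filter (fun X => r X W')).card : ℚ) := by
            apply sum_le_sum
            intro W hW
            rw [mem_filter] at hW
            have h1 := hLYM W hW.1 W' hW' hW.2
            have h1' : ((D.filter (fun X => r X W')).card : ℚ) ≤ ((U.filter (fun X' => r W X')).card : ℚ) := by
              exact_mod_cast h1
            exact one_div_le_one_div_of_le hp h1'
        _ = 1 := by
            rw [sum_const, nsmul_eq_mul, mul_one_div_cancel hp.ne']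
  have hfinal : (D.card : ℚ) ≤ (U.card : ℚ) := by
    rw [key, hswap]
    calc (∑ W' ∈ U, ∑ W ∈ D,
        (if r W W' then (1 : ℚ) / ((U.filter (fun X' => r W X')).card : ℚ) else 0))
        ≤ ∑ W' ∈ U, (1 : ℚ) := sum_le_sum hunit
      _ = (U.card : ℚ) := by rw [sum_const, nsmul_eq_mul, mul_one]
  exact_mod_cast hfinal

end LocalLYM

section InOutLYM

variable {N : Matroid α} [N.Finite] {e : α}

/-- One more point: an independent finset of rank below `ρ(E)` extends by a point of `E` outside it. -/
theorem exists_insert_rk_eq_card_of_rk_lt' {Z : Finset α} (hZg : Z ⊆ gr N) (hZr : rk N Z = Z.card)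
    (hlt : rk N Z < rk N (gr N)) : ∃ x ∈ gr N, x ∉ Z ∧ rk N (insert x Z) = (insert x Z).card := by
  by_contra hcon
  simp only [not_exists, not_and] at hcon
  have hsub : gr N ⊆ clF N Z := by
    intro x hx
    by_cases hxZ : x ∈ Z
    · exact mem_clF_of_mem_of_subset_gr hZg hxZ
    · have h := hcon x hx hxZ
      rw [rk_insert_eq hx hZg] at h
      split_ifs at h with hcl
      · exact hcl
      · exact absurd (by rw [card_insert_of_notMem hxZ, hZr]) h
  have := rk_le_rk_of_subset_clF hsub
  omega

/-- **Independent extension inside the ground set**: an independent `W` extends by `k` points of `E ∖ W` to an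
independent set whenever `#W + k ≤ ρ(E)`. -/
theorem exists_indep_extension {W : Finset α} (hWg : W ⊆ gr N) (hWrk : rk N W = W.card) (k : ℕ)
    (hk : W.card + k ≤ rk N (gr N)) :
    ∃ Z ⊆ gr N \ W, Z.card = k ∧ rk N (W ∪ Z) = (W ∪ Z).card := by
  induction k with
  | zero => exact ⟨∅, empty_subset _, card_empty, by rw [union_empty]; exact hWrk⟩
  | succ k ih =>
    obtain ⟨Z, hZ, hZk, hZr⟩ := ih (by omega)
    have hZg : W ∪ Z ⊆ gr N := union_subset hWg (hZ.trans sdiff_subset)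
    have hdisj : Disjoint W Z := (subset_sdiff.1 hZ).2.symm
    have hcard : (W ∪ Z).card = W.card + k := by rw [card_union_of_disjoint hdisj, hZk]
    obtain ⟨x, hxg, hxWZ, hxr⟩ := exists_insert_rk_eq_card_of_rk_lt' hZg hZr (by rw [hZr, hcard]; omega)
    refine ⟨insert x Z, ?_, ?_, ?_⟩
    · intro g hg
      rw [mem_insert] at hg
      rcases hg with rfl | hg
      · exact mem_sdiff.2 ⟨hxg, fun h => hxWZ (mem_union_left _ h)⟩
      · exact hZ hg
    · rw [card_insert_of_notMem (fun h => hxWZ (mem_union_right _ h)), hZk]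
    · rw [union_insert]; exact hxr

/-- The units disjoint from a demand `W` are the `5`-subsets of the basis `E ∖ W` whose complement is independent
(they are independent as subsets of a basis, and avoid `e ∈ W`). -/
theorem card_filter_disjoint_units_eq {W : Finset α}
    (hW : W ∈ (biIndepSets N 4).filter (fun W => e ∈ W)) :
    (((biIndepSets N 5).filter (fun W' => e ∉ W')).filter (fun W' => W ∩ W' = ∅)).card =
      (((gr N \ W).powersetCard 5).filter (fun X => rk N (gr N \ X) = (gr N \ X).card)).card := by
  rw [mem_filter, mem_biIndepSets] at hW
  obtain ⟨⟨hWg, hW4, hWrk, hWc⟩, heW⟩ := hW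
  congr 1
  ext X
  rw [mem_filter, mem_filter, mem_biIndepSets, mem_filter, mem_powersetCard]
  constructor
  · rintro ⟨⟨⟨hXg, hX5, _, hXc⟩, _⟩, hWX⟩
    refine ⟨⟨subset_sdiff.2 ⟨hXg, disjoint_iff_inter_eq_empty.2 (by rw [inter_comm]; exact hWX)⟩, hX5⟩, hXc⟩
  · rintro ⟨⟨hXB, hX5⟩, hXc⟩
    have hXg : X ⊆ gr N := hXB.trans sdiff_subset
    have hdisj : Disjoint X W := (subset_sdiff.1 hXB).2
    refine ⟨⟨⟨hXg, hX5, ?_, hXc⟩, fun heX => (mem_sdiff.1 (hXB heX)).2 heW⟩, ?_⟩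
    · exact rk_eq_card_of_subset_of_rk_eq_card hXB hWc
    · rw [inter_comm]; exact disjoint_iff_inter_eq_empty.1 hdisj

/-- **The units' degrees**: for a unit `W'` and a disjoint demand `W`, with `Y := E ∖ W ∖ W'`, every demand `X`
disjoint from `W'` is determined by `(X ∩ W) − e ⊆ W − e` and `Z := X ∩ Y` with `E ∖ Z` spanning; hence
`p(W') ≤ ι₀ + 3·ι₁ + 3·ι₂ + ι₃` with `ι_j := #{Z ∈ C(Y, j) : E ∖ Z spans}` (and `ι₀ = 1`, `ι₁ ≤ #Y`). -/
theorem card_filter_disjoint_demands_le_I (hn : (gr N).card = rk N (gr N) + 4) {W W' : Finset α}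
    (hW : W ∈ (biIndepSets N 4).filter (fun W => e ∈ W))
    (hW' : W' ∈ (biIndepSets N 5).filter (fun W' => e ∉ W')) :
    (((biIndepSets N 4).filter (fun W => e ∈ W)).filter (fun X => X ∩ W' = ∅)).card ≤
      ∑ j ∈ Finset.range 4, (Nat.choose 3 (3 - j)) *
        ((((gr N \ W) \ W').powersetCard j).filter (fun Z => rk N (gr N \ Z) = rk N (gr N))).card := by
  rw [mem_filter, mem_biIndepSets] at hW hW'
  obtain ⟨⟨hWg, hW4, hWrk, hWc⟩, heW⟩ := hW
  obtain ⟨⟨hW'g, hW'5, hW'rk, hW'c⟩, heW'⟩ := hW'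
  set Y := (gr N \ W) \ W' with hYdef
  -- the demands disjoint from `W'`, split by `#(X ∩ Y)`
  set Dd := ((biIndepSets N 4).filter (fun W => e ∈ W)).filter (fun X => X ∩ W' = ∅) with hDd
  have hsplit : Dd.card = ∑ j ∈ Finset.range 4, (Dd.filter (fun X => (X ∩ Y).card = j)).card := by
    rw [← card_biUnion]
    · congr 1
      ext X
      rw [mem_biUnion]
      constructor
      · intro hX
        refine ⟨(X ∩ Y).card, ?_, mem_filter.2 ⟨hX, rfl⟩⟩
        rw [Finset.mem_range]
        have hXD := (mem_filter.1 (mem_filter.1 hX).1).1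
        have heX := (mem_filter.1 (mem_filter.1 hX).1).2
        rw [mem_biIndepSets] at hXD
        have heY : e ∉ Y := fun h => (mem_sdiff.1 (mem_sdiff.1 h).1).2 heW
        have h1 : X ∩ Y ⊆ X.erase e := by
          intro g hg
          rw [mem_inter] at hg
          exact mem_erase.2 ⟨fun h => heY (h ▸ hg.2), hg.1⟩
        have h2 := card_le_card h1
        rw [card_erase_of_mem heX, hXD.2.1] at h2
        omega
      · rintro ⟨j, _, hX⟩
        exact (mem_filter.1 hX).1
    · intro i _ j _ hij
      rw [Function.onFun, disjoint_left]
      intro X hXi hXj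
      rw [mem_filter] at hXi hXj
      exact hij (hXi.2.symm.trans hXj.2)
  rw [hsplit]
  apply sum_le_sum
  intro j hj
  rw [Finset.mem_range] at hj
  -- the injection `X ↦ ((X ∩ W).erase e, X ∩ Y)`
  have htarget : ((W.erase e).powersetCard (3 - j) ×ˢ
      (Y.powersetCard j).filter (fun Z => rk N (gr N \ Z) = rk N (gr N))).card =
      (Nat.choose 3 (3 - j)) * ((Y.powersetCard j).filter (fun Z => rk N (gr N \ Z) = rk N (gr N))).card := by
    rw [card_product, card_powersetCard, card_erase_of_mem heW, hW4]
  rw [← htarget]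
  apply card_le_card_of_injOn (fun X => ((X ∩ W).erase e, X ∩ Y))
  · intro X hX
    rw [mem_coe, mem_filter] at hX
    obtain ⟨hX, hXYj⟩ := hX
    rw [mem_filter, mem_filter, mem_biIndepSets] at hX
    obtain ⟨⟨⟨hXg, hX4, hXrk, hXc⟩, heX⟩, hXW'⟩ := hX
    rw [mem_coe, mem_product, mem_powersetCard, mem_filter, mem_powersetCard]
    have hXsub : X ⊆ W ∪ Y := by
      intro g hg
      rw [mem_union]
      by_cases hgW : g ∈ W
      · exact Or.inl hgW
      · refine Or.inr ?_
        rw [hYdef, mem_sdiff, mem_sdiff]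
        refine ⟨⟨hXg hg, hgW⟩, fun hgW' => ?_⟩
        have : g ∈ X ∩ W' := mem_inter.2 ⟨hg, hgW'⟩
        rw [hXW'] at this
        exact notMem_empty g this
    have hWY : Disjoint W Y := by
      rw [hYdef]
      exact disjoint_sdiff.mono_right sdiff_subset
    have hcardXW : (X ∩ W).card + (X ∩ Y).card = 4 := by
      rw [← hX4, ← card_union_of_disjoint (hWY.mono inter_subset_right inter_subset_right),
        ← inter_union_distrib_left, inter_eq_left.2 hXsub]
    refine ⟨⟨erase_subset_erase e inter_subset_right, ?_⟩, ⟨inter_subset_right, hXYj⟩, ?_⟩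
    · rw [card_erase_of_mem (mem_inter.2 ⟨heX, heW⟩)]
      omega
    · -- `E ∖ (X ∩ Y)` contains the basis `E ∖ X`
      have h1 := rk_mono' (M := N) (show gr N \ X ⊆ gr N \ (X ∩ Y) from sdiff_subset_sdiff (Subset.refl _) inter_subset_left)
      have h2 := rk_mono' (M := N) (sdiff_subset (s := gr N) (t := X ∩ Y))
      rw [hXc, card_sdiff_of_subset hXg, hX4] at h1
      show rk N (gr N \ (X ∩ Y)) = rk N (gr N)
      omega
  · intro X₁ hX₁ X₂ hX₂ h
    rw [mem_coe, mem_filter] at hX₁ hX₂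
    simp only [Prod.mk.injEq] at h
    obtain ⟨hAeq, hZeq⟩ := h
    have hrec : ∀ X ∈ Dd, X = insert e ((X ∩ W).erase e) ∪ (X ∩ Y) := by
      intro X hX
      rw [mem_filter, mem_filter, mem_biIndepSets] at hX
      obtain ⟨⟨⟨hXg, _, _, _⟩, heX⟩, hXW'⟩ := hX
      rw [insert_erase (mem_inter.2 ⟨heX, heW⟩), ← inter_union_distrib_left]
      symm
      rw [inter_eq_left]
      intro g hg
      rw [mem_union]
      by_cases hgW : g ∈ W
      · exact Or.inl hgW
      · refine Or.inr ?_
        rw [hYdef, mem_sdiff, mem_sdiff]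
        refine ⟨⟨hXg hg, hgW⟩, fun hgW' => ?_⟩
        have : g ∈ X ∩ W' := mem_inter.2 ⟨hg, hgW'⟩
        rw [hXW'] at this
        exact notMem_empty g this
    rw [hrec X₁ hX₁.1, hrec X₂ hX₂.1, hAeq, hZeq]

/-- **THE STATEMENT (***)** (a `Prop`; NOT asserted; §59 ADDENDUM 4): on every coloop-free matroid of nullity `4`, for
every `5`-set `S` whose complement is independent (a spanning `5`-set of the dual) and every `Y ⊆ E ∖ S` with at least
three points, `1 + 3·#Y + 3·ι₂(Y) + ι₃(Y) ≤ #{X ∈ C(S ∪ Y, 5) : E ∖ X independent}`, with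
`ι_j(Y) := #{Z ∈ C(Y, j) : E ∖ Z spans}` — in the dual, the spanning `5`-subsets of `S ∪ Y` are at least
`1 + 3#Y + 3ι₂ + ι₃`.  Exhaustively true for `#Y = 3` and `#Y = 4` (every loopless rank-`4` matroid on `8` resp. `9`
elements, ADDENDUM 5), 0 failures on ≈ `10⁸` random cases with `#Y ≤ 6`, tight at `#Y = 3`. -/
def StarStar (α : Type) [DecidableEq α] : Prop :=
  ∀ (N : Matroid α) [N.Finite] (S Y : Finset α), (gr N).card = rk N (gr N) + 4 →
    (∀ x ∈ gr N, rk N ((gr N).erase x) = rk N (gr N)) → S ⊆ gr N → S.card = 5 →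
    rk N (gr N \ S) = (gr N \ S).card → Y ⊆ gr N \ S → 3 ≤ Y.card →
    1 + 3 * Y.card + 3 * ((Y.powersetCard 2).filter (fun Z => rk N (gr N \ Z) = rk N (gr N))).card +
      ((Y.powersetCard 3).filter (fun Z => rk N (gr N \ Z) = rk N (gr N))).card ≤
      (((S ∪ Y).powersetCard 5).filter (fun X => rk N (gr N \ X) = (gr N \ X).card)).card

omit [DecidableEq α] in
/-- `ι₀ = 1` and `ι₁ ≤ #Y`: the sum of `card_filter_disjoint_demands_le_I` is at most `1 + 3#Y + 3ι₂ + ι₃`. -/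
theorem sum_I_le (Y : Finset α) (f : Finset α → Prop) [DecidablePred f] (h0 : f ∅) :
    (∑ j ∈ Finset.range 4, (Nat.choose 3 (3 - j)) * ((Y.powersetCard j).filter f).card) ≤
      1 + 3 * Y.card + 3 * ((Y.powersetCard 2).filter f).card + ((Y.powersetCard 3).filter f).card := by
  rw [Finset.sum_range_succ, Finset.sum_range_succ, Finset.sum_range_succ, Finset.sum_range_one]
  have h₀ : ((Y.powersetCard 0).filter f).card = 1 := by
    rw [powersetCard_zero, filter_singleton, if_pos h0, card_singleton]
  have h₁ : ((Y.powersetCard 1).filter f).card ≤ Y.card := by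
    calc ((Y.powersetCard 1).filter f).card ≤ (Y.powersetCard 1).card := card_filter_le _ _
      _ = Y.card := by rw [card_powersetCard, Nat.choose_one_right]
  simp only [Nat.sub_zero, Nat.choose_self, Nat.sub_self, Nat.choose_zero_right] at *
  have e1 : Nat.choose 3 (3 - 1) = 3 := by decide
  have e2 : Nat.choose 3 (3 - 2) = 3 := by decide
  rw [e1, e2, h₀]
  omega

/-- **`InOutBottomFour` AT `ρ ≥ 8` MODULO (***)**: on every coloop-free matroid with `#E = ρ(E) + 4`, `ρ(E) ≥ 8`,
`in_4(e) ≤ out_5(e)` for every `e ∈ E`, under `StarStar`.  Every demand has a neighbour (a `5`-subset of the basis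
`E ∖ W` with independent complement: extend `W` to a basis inside `E ∖ W`), and on every edge `(W, W')` the local LYM
`p(W') ≤ 1 + 3#Y + 3ι₂ + ι₃ ≤ s(W)` holds by `StarStar` with `S := W'`, `Y := E ∖ W ∖ W'` (`#Y = ρ − 5 ≥ 3`). -/
theorem inCount_four_le_outCount_five_of_starStar (hss : StarStar α) (hn : (gr N).card = rk N (gr N) + 4)
    (hR : 8 ≤ rk N (gr N)) (hcf : ∀ x ∈ gr N, rk N ((gr N).erase x) = rk N (gr N)) :
    inCount N 4 e ≤ outCount N 5 e := by
  unfold inCount outCount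
  apply card_le_card_of_localLYM (fun W W' => W ∩ W' = ∅)
  · -- every demand has a neighbour
    intro W hW
    rw [card_filter_disjoint_units_eq hW, card_pos]
    rw [mem_filter, mem_biIndepSets] at hW
    obtain ⟨⟨hWg, hW4, hWrk, hWc⟩, heW⟩ := hW
    obtain ⟨Z, hZ, hZk, hZr⟩ := exists_indep_extension hWg hWrk (rk N (gr N) - 5) (by omega)
    refine ⟨(gr N \ W) \ Z, ?_⟩
    rw [mem_filter, mem_powersetCard]
    have hBcard : (gr N \ W).card = rk N (gr N) := by rw [card_sdiff_of_subset hWg, hn, hW4]; omega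
    have hcompl : gr N \ ((gr N \ W) \ Z) = W ∪ Z := by
      ext g
      rw [mem_sdiff, mem_sdiff, mem_sdiff, mem_union]
      constructor
      · rintro ⟨hg, h⟩
        by_cases hgW : g ∈ W
        · exact Or.inl hgW
        · exact Or.inr (by by_contra hgZ; exact h ⟨⟨hg, hgW⟩, hgZ⟩)
      · rintro (h | h)
        · exact ⟨hWg h, fun h' => h'.1.2 h⟩
        · exact ⟨(mem_sdiff.1 (hZ h)).1, fun h' => h'.2 h⟩
    refine ⟨⟨sdiff_subset, ?_⟩, ?_⟩
    · rw [card_sdiff_of_subset hZ, hBcard, hZk]; omega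
    · rw [hcompl]; exact hZr
  · intro W hW W' hW' hWW'
    have h1 := card_filter_disjoint_demands_le_I hn hW hW'
    have h2 := sum_I_le ((gr N \ W) \ W') (fun Z => rk N (gr N \ Z) = rk N (gr N)) (by rw [sdiff_empty])
    rw [card_filter_disjoint_units_eq hW]
    have hW'' := hW'
    rw [mem_filter, mem_biIndepSets] at hW''
    obtain ⟨⟨hW'g, hW'5, hW'rk, hW'c⟩, heW'⟩ := hW''
    have hW2 := hW
    rw [mem_filter, mem_biIndepSets] at hW2
    obtain ⟨⟨hWg, hW4, hWrk, hWc⟩, heW⟩ := hW2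
    have hY : (gr N \ W) \ W' ⊆ gr N \ W' := by
      intro g hg
      rw [mem_sdiff] at hg ⊢
      exact ⟨(mem_sdiff.1 hg.1).1, hg.2⟩
    have hYcard : 3 ≤ ((gr N \ W) \ W').card := by
      have hW'B : W' ⊆ gr N \ W :=
        subset_sdiff.2 ⟨hW'g, disjoint_iff_inter_eq_empty.2 (by rw [inter_comm]; exact hWW')⟩
      rw [card_sdiff_of_subset hW'B, card_sdiff_of_subset hWg, hW4, hW'5]
      omega
    have h3 := hss N W' ((gr N \ W) \ W') hn hcf hW'g hW'5 hW'c hY hYcard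
    -- `W' ∪ Y = E ∖ W`
    have hSY : W' ∪ ((gr N \ W) \ W') = gr N \ W := by
      rw [union_sdiff_self_eq_union, union_eq_right]
      exact subset_sdiff.2 ⟨hW'g, disjoint_iff_inter_eq_empty.2 (by rw [inter_comm]; exact hWW')⟩
    rw [hSY] at h3
    omega

end InOutLYM

end PercRepro.Cogirth
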